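import Literature.NumberTheory.CubicFields.HasseCubicClassFields
import Literature.NumberTheory.QuadraticFields.CubicClassFieldNormal
import Literature.NumberTheory.QuadraticFields.ThreeTorsionProofs
import Literature.NumberTheory.QuadraticFields.UnitsModCubes
import Literature.NumberTheory.NumberFields.ScholzKummerGenerator
import Literature.NumberTheory.NumberFields.ValuationCubeClassGroup
import Literature.NumberTheory.NumberFields.AlgClosureCubeRootsOfUnity
import HarnessLib

/-!
# Scholz's reflection theorem, the count: `#Cl(K)[3] ≤ #(U_k/U_k³) · #Cl(k)[3]` for a quadratic
# field `K` and its mirror field `k ⊆ K(ζ₃)`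

Topic `NumberTheory/QuadraticFields`.  Theorem-only file (no definition, no named fact), the
Kummer-theoretic inequality of Scholz's reflection theorem (A. Scholz 1932; L. C. Washington,
*Introduction to Cyclotomic Fields*, Thm. 10.10 and its proof), assembled from the tree's pieces:

* the cubic class fields `E_S ⊆ K̄` of the index-`3` subgroups `S ≤ Cl(𝓞_K)`
  (`exists_isCubicClassField`, Artin reciprocity; distinct `S` give distinct fields,
  `eq_of_isCubicClassField`), `2 · #{S} + 1 = #Cl(𝓞_K)[3]`
  (`two_mul_card_subgroup_index_three_add_one`);
* for `K` quadratic these are normal over `ℚ` with `Gal(K/ℚ)` acting by inversion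
  (`CubicClassFieldNormal.lean`), so each has a **Scholz Kummer generator** `θ_S` in the mirror
  field `k = K(ζ₃)^{g}` (`g|_K ≠ 1`, `g ζ₃ = ζ₃²`): `θ_S = λ_S³` with `E_S ⊆ F` for every field
  `F ⊇ K(ζ₃) ∪ {λ_S}`, `θ_S ∉ K(ζ₃)³`, `3 ∣ v(θ_S)` for every prime `v` of `k`
  (`exists_kummer_generator`);
* the `θ_S` are pairwise independent modulo cubes of `k`: `θ_S ∈ θ_T^{±1} k׳` puts `λ_S` in
  `E_T(ζ₃)`, hence `E_S ⊆ E_T(ζ₃)` and `E_S = E_T` (`eq_of_le_sup_adjoin`), `S = T`;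
* the count of lines of virtual cubes `2m + 1 ≤ #(𝓞_kˣ/𝓞_kˣ³) · #Cl(𝓞_k)[3]`
  (`two_mul_card_add_one_le_of_dvd_valuation`, the exact sequence
  `1 → U_k/U_k³ → {β : (β) = 𝔟³}/k׳ → Cl(k)[3] → 1`).

Main statement: `Scholz1932.natCard_threeTorsion_le_mul` —
`#Cl(𝓞_K)[3] ≤ #(𝓞_kˣ/𝓞_kˣ³) · #Cl(𝓞_k)[3]` for every quadratic `K ∌ ζ₃` and every number field
`k ⊆ K̄` with `k ⊆ K(ζ₃)` and `K(ζ₃)^{g} ⊆ k` (Washington, proof of Thm. 10.10: "the `3`-rank of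
the class group equals the number of independent unramified cyclic cubic extensions … each comes
from `(β) = 𝔟³` in the other field … `dim V = r + rank E/E³`").  The printed theorem
`r ≤ s ≤ r + 1` follows in `ScholzReflectionHolds.lean` by taking for `k` the imaginary
(`U/U³ = 1`) resp. real (`#U/U³ = 3`) mirror field.

## References

* A. Scholz, *Über die Beziehung der Klassenzahlen quadratischer Körper zueinander*, J. reine
  angew. Math. 166 (1932), 201–203. [Scholz1932]
* L. C. Washington, *Introduction to Cyclotomic Fields*, GTM 83, 2nd ed. (1997), Thm. 10.10 and
  its proof. [Washington1997]
-/

noncomputable section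

open NumberField Module IsDedekindDomain WithZero
open scoped IntermediateField nonZeroDivisors

namespace Literature.NumberTheory.QuadraticFields

namespace Scholz1932

open Literature.NumberTheory.NumberFields Literature.NumberTheory.CubicFields
  Literature.NumberTheory.QuadraticFields.Quadratic

variable {K : Type} [Field K] [NumberField K] [IsGalois ℚ K]

omit [NumberField K] [IsGalois ℚ K] in
/-- **Independence of the Kummer generators.**  In a field `Ω ⊇ K`, let `λ₁³ = θ₁`, `λ₂³ = θ₂` with
`θ₂ ≠ 0`, and suppose `θ₁ = θ₂ z³` or `θ₁ = θ₂⁻¹ z³`.  Then `λ₁ = ω λ₂ z` resp. `λ₁ = ω z λ₂⁻¹` for a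
cube root of unity `ω`, so `λ₁` lies in every intermediate field containing `λ₂`, `z` and the cube
roots of unity. [folklore] -/
private theorem mem_of_pow_three_eq {F : IntermediateField K (AlgebraicClosure K)}
    (hω : ∀ ω : AlgebraicClosure K, ω ^ 3 = 1 → ω ∈ F)
    {lam₁ lam₂ θ₁ θ₂ z : AlgebraicClosure K} (h₁ : lam₁ ^ 3 = θ₁) (h₂ : lam₂ ^ 3 = θ₂)
    (hθ₂ : θ₂ ≠ 0) (hlam₂ : lam₂ ∈ F) (hz : z ∈ F)
    (h : θ₁ = θ₂ * z ^ 3 ∨ θ₁ = θ₂⁻¹ * z ^ 3) : lam₁ ∈ F := by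
  have hlam₂0 : lam₂ ≠ 0 := by
    rintro rfl
    exact hθ₂ (by rw [← h₂]; ring)
  rcases h with h | h
  · -- `λ₁³ = (λ₂ z)³`
    by_cases hz0 : z = 0
    · have : lam₁ = 0 := by
        have h3 : lam₁ ^ 3 = 0 := by rw [h₁, h, hz0]; ring
        exact pow_eq_zero_iff (n := 3) (by norm_num) |>.mp h3
      rw [this]
      exact zero_mem F
    have hb : lam₂ * z ≠ 0 := mul_ne_zero hlam₂0 hz0
    obtain ⟨ω, hω3, hωeq⟩ :=
      exists_eq_mul_of_pow_three_eq hb (by rw [h₁, h, mul_pow, h₂])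
    rw [hωeq]
    exact mul_mem (hω ω hω3) (mul_mem hlam₂ hz)
  · -- `(λ₁ λ₂)³ = z³`
    by_cases hz0 : z = 0
    · have h3 : (lam₁ * lam₂) ^ 3 = 0 := by rw [mul_pow, h₁, h₂, h, hz0]; simp
      have h0 : lam₁ * lam₂ = 0 := pow_eq_zero_iff (n := 3) (by norm_num) |>.mp h3
      rcases mul_eq_zero.mp h0 with h0 | h0
      · rw [h0]; exact zero_mem F
      · exact absurd h0 hlam₂0
    obtain ⟨ω, hω3, hωeq⟩ := exists_eq_mul_of_pow_three_eq hz0 (a := lam₁ * lam₂) (by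
      rw [mul_pow, h₁, h₂, h, mul_comm, ← mul_assoc, mul_inv_cancel₀ hθ₂, one_mul])
    have hlam₁ : lam₁ = ω * z * lam₂⁻¹ := by
      rw [← hωeq, mul_assoc, mul_inv_cancel₀ hlam₂0, mul_one]
    rw [hlam₁]
    exact mul_mem (mul_mem (hω ω hω3) hz) (inv_mem hlam₂)

set_option maxHeartbeats 400000 in
/-- **Scholz's reflection inequality** (Washington, *Introduction to Cyclotomic Fields*, proof of
Thm. 10.10).  Let `K` be a quadratic field, `ζ = ζ₃ ∈ K̄ ∖ K`, `g ∈ Aut(K̄/ℚ)` non-trivial on `K`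
with `g ζ = ζ²`, and `k ⊆ K̄` a number field with `k ⊆ K(ζ)` and `K(ζ)^{g} ⊆ k` (the mirror field
`ℚ(√-3d)` of `K = ℚ(√d)`).  Then

  `#Cl(𝓞_K)[3] ≤ #(𝓞_kˣ/𝓞_kˣ³) · #Cl(𝓞_k)[3]`.

Proof: the `m = (#Cl(K)[3] − 1)/2` index-`3` subgroups of `Cl(𝓞_K)` have distinct cubic class
fields `E_S` (Artin reciprocity), normal over `ℚ` and dihedral; their Scholz Kummer generators
`θ_S ∈ k` (`θ_S = λ_S³`, `L_S = E_S(ζ) = K(ζ)(λ_S)`, `(θ_S) = 𝔟³`, `θ_S ∉ K(ζ)³`) are pairwise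
independent modulo `k׳` (a relation `θ_S ∈ θ_T^{±1}k׳` gives `λ_S ∈ E_T(ζ)`, so
`E_S ⊆ E_T(ζ)`, `E_S = E_T`, `S = T`), and `2m + 1 ≤ #(U_k/U_k³)·#Cl(k)[3]` by the Kummer/Selmer
count. [cite: Washington1997, Thm 10.10 (proof)] [cite: Scholz1932, pp. 201–203] -/
theorem natCard_threeTorsion_le_mul (h2 : finrank ℚ K = 2)
    {ζ : AlgebraicClosure K} (hζ : IsPrimitiveRoot ζ 3)
    (hζK : ζ ∉ Set.range (algebraMap K (AlgebraicClosure K)))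
    {g : AlgebraicClosure K ≃ₐ[ℚ] AlgebraicClosure K} (hgK : g.restrictNormal K ≠ 1)
    (hgζ : g ζ = ζ ^ 2)
    (k : IntermediateField ℚ (AlgebraicClosure K)) [NumberField k]
    (hkM : ∀ x : AlgebraicClosure K, x ∈ k → x ∈ K⟮ζ⟯)
    (hMk : ∀ x ∈ K⟮ζ⟯, g x = x → x ∈ k)
    [Finite ((𝓞 k)ˣ ⧸ unitCubes k)] :
    Nat.card {c : ClassGroup (𝓞 K) // c ^ 3 = 1} ≤
      Nat.card ((𝓞 k)ˣ ⧸ unitCubes k) * Nat.card {c : ClassGroup (𝓞 k) // c ^ 3 = 1} := by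
  classical
  -- the index-`3` subgroups and their cubic class fields
  choose E hfd hgal h3 hunr ψ χ hker hχ hfrob using
    fun S : {S : Subgroup (ClassGroup (𝓞 K)) // S.index = 3} =>
      exists_isCubicClassField (K := K) S.2
  -- the Kummer generators in `k`
  have hgen : ∀ S : {S : Subgroup (ClassGroup (𝓞 K)) // S.index = 3},
      ∃ (θ : k) (lam : AlgebraicClosure K), θ ≠ 0 ∧ lam ∈ E S ⊔ K⟮ζ⟯ ∧
        lam ^ 3 = (θ : AlgebraicClosure K) ∧
        (∀ m ∈ K⟮ζ⟯, m ^ 3 ≠ (θ : AlgebraicClosure K)) ∧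
        (∀ F : IntermediateField K (AlgebraicClosure K), K⟮ζ⟯ ≤ F → lam ∈ F → E S ≤ F) ∧
        ∀ v : HeightOneSpectrum (𝓞 k), (3 : ℤ) ∣ log (v.valuation k θ) := by
    intro S
    haveI := hfd S
    haveI := hgal S
    exact exists_kummer_generator h2 hζ hζK hgζ k hkM hMk (E S) (h3 S) (hunr S)
      (fun x hx => apply_mem_of_frobData h2 (hunr S) (hχ S) (hfrob S) g hx)
      (fun h y hy => apply_apply_eq_symm_apply_of_frobData h2 (hunr S) (hχ S) (hfrob S) g hgK h hy)
  choose θ lam hθ0 hlamL hlam3 hnc hgenF hval using hgen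
  -- the count of independent virtual cubes in `k`
  have key := two_mul_card_add_one_le_of_dvd_valuation k (fun S => Units.mk0 (θ S) (hθ0 S))
    (fun S v => by rw [Units.val_mk0]; exact hval S v) ?_ ?_
  · rwa [two_mul_card_subgroup_index_three_add_one] at key
  · -- `θ_S` is not a cube in `k` (not even in `K(ζ) ⊇ k`)
    intro S z hz
    have hz3 : ((z : kˣ) : k) ^ 3 = θ S := by
      have h := congrArg Units.val hz
      rw [Units.val_mk0, Units.val_pow_eq_pow_val] at h
      exact h.symm
    refine hnc S (((z : kˣ) : k) : AlgebraicClosure K) (hkM _ ((z : kˣ) : k).2) ?_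
    rw [← hz3]
    rfl
  · -- independence modulo cubes
    intro S T z hST
    haveI := hfd S
    haveI := hgal S
    haveI := hfd T
    haveI := hgal T
    -- `λ_S ∈ E_T(ζ)`
    have hθT0 : ((θ T : k) : AlgebraicClosure K) ≠ 0 := by
      intro h0
      exact hθ0 T (Subtype.ext h0)
    have hKζ_le : K⟮ζ⟯ ≤ E T ⊔ K⟮ζ⟯ := le_sup_right
    have hlamS : lam S ∈ E T ⊔ K⟮ζ⟯ := by
      refine mem_of_pow_three_eq (F := E T ⊔ K⟮ζ⟯)
        (fun ω hω => hKζ_le (mem_adjoin_of_pow_three_eq_one hζ hω)) (hlam3 S) (hlam3 T) hθT0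
        (hlamL T) (hKζ_le (hkM _ ((z : kˣ) : k).2)) ?_
      rcases hST with h | h
      · left
        have h' := congrArg (fun u : kˣ => ((u : k) : AlgebraicClosure K)) h
        simp only [Units.val_mk0, Units.val_mul, Units.val_pow_eq_pow_val] at h'
        rw [h']
        push_cast
        rfl
      · right
        have h' := congrArg (fun u : kˣ => ((u : k) : AlgebraicClosure K)) h
        simp only [Units.val_mk0, Units.val_mul, Units.val_pow_eq_pow_val, Units.val_inv_eq_inv_val]
          at h'
        rw [h']
        push_cast
        rfl
    -- hence `E_S ⊆ E_T(ζ)`, `E_S = E_T`, `S = T`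
    have hle : E S ≤ E T ⊔ K⟮ζ⟯ := hgenF S _ hKζ_le hlamS
    have hEST : E S = E T := eq_of_le_sup_adjoin hζ hζK (h3 S) (h3 T) hle
    obtain ⟨χ', hχ', hfrob'⟩ := exists_frobData_of_eq hEST (hχ T) (hfrob T)
    exact Subtype.ext
      (eq_of_isCubicClassField (h3 S) (hker S) (hχ S) (hfrob S) (hker T) hfrob' S.2 T.2)

end Scholz1932

end Literature.NumberTheory.QuadraticFields

end
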